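import Summits.Ventures.PercRepro.C041PointZone
import Summits.Ventures.PercRepro.C041PendantCone
import Summits.Ventures.PercRepro.C041AnchorGlueSix
import Summits.Ventures.PercRepro.C041ZoneIso

/-!
# ROW C-041 — THE CLASS 𝒵 IN THE SIX-VECTOR FORM: generated from marked points by pendant attachment and gluing at
the anchor, every member's six-vector lies in the cone, hence the ZONE O-CUBE (p6, gen 29; mine-3's C-041.md
§20 (b)(3))

`IsZc Z k` — the anchored zones generated from the MARKED POINT (`C041PointZone`) by PENDANT ATTACHMENT at any
vertex of any unmarked multigraph (`C041PendantCone`), by GLUING AT THE ANCHOR (`C041AnchorGlueSix`) and by zone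
isomorphism (`C041ZoneIso`, six-vector transport `ZoneIso.sixVec_eq`).  THE THEOREM: the six-vector of every member
lies in mine-3's cone (`IsZc.inCone`, by induction, every choice of the finiteness instances), hence (P), the
one-anchor (CS) and the ZONE O-CUBE (`IsZc.zoneCSConj`, `IsZc.zoneOCubeConj`).  This is mine-3's class 𝒵 («every
block of the block–cut tree rooted at the anchor has at most one exit towards the marks») with BOTH of its
operations, generated from its simplest seed — all trees are in it up to isomorphism (a tree is marked points glued
at the anchor through pendant edges), as is every zone whose marked blocks each have a single exit.
-/

namespace PercRepro

namespace ZoneZ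

open ZoneData TreeClosure Pendant AnchorGlue PointZone Finset

/-! ## The six-vector transports along zone isomorphisms -/

namespace ZoneIso

variable {V E T₁ T₂ V' E' T₁' T₂' : Type*} {Z : ZoneData V E T₁ T₂} {Z' : ZoneData V' E' T₁' T₂'}
  (φ : ZoneIso Z Z') [Fintype E] [DecidableEq E] [Fintype T₁] [DecidableEq T₁] [Fintype T₂] [DecidableEq T₂]
  [Fintype E'] [DecidableEq E'] [Fintype T₁'] [DecidableEq T₁'] [Fintype T₂'] [DecidableEq T₂'] (k : V)

/-- `#(F + T₁)` transports. -/
theorem card_FAset : #(Z'.FAset (φ.v k)) = #(Z.FAset k) := by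
  symm
  refine Finset.card_equiv φ.state fun σ => ?_
  rw [mem_FAset, mem_FAset, φ.adm_iff, φ.mem_D2_iff]

/-- `#(F + T₂)` transports. -/
theorem card_FBset : #(Z'.FBset (φ.v k)) = #(Z.FBset k) := by
  symm
  refine Finset.card_equiv φ.state fun σ => ?_
  rw [mem_FBset, mem_FBset, φ.adm_iff, φ.mem_D_iff]

/-- `#I_F` transports. -/
theorem card_IFset : #(Z'.IFset (φ.v k)) = #(Z.IFset k) := by
  symm
  refine Finset.card_equiv φ.state fun σ => ?_
  rw [mem_IFset, mem_IFset, φ.adm_iff, φ.blueK_iff, φ.mem_D_iff, φ.mem_D2_iff]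

/-- `#(I_F + I₁)` transports. -/
theorem card_IAset : #(Z'.IAset (φ.v k)) = #(Z.IAset k) := by
  symm
  refine Finset.card_equiv φ.state fun σ => ?_
  rw [mem_IAset, mem_IAset, φ.adm_iff, φ.blueK_iff, φ.mem_D2_iff]

/-- `#(I_F + I₂)` transports. -/
theorem card_IBset : #(Z'.IBset (φ.v k)) = #(Z.IBset k) := by
  symm
  refine Finset.card_equiv φ.state fun σ => ?_
  rw [mem_IBset, mem_IBset, φ.adm_iff, φ.blueK_iff, φ.mem_D_iff]

/-- **The six-vector transports along a zone isomorphism.** -/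
theorem sixVec_eq : Z'.sixVec (φ.v k) = Z.sixVec k := by
  unfold sixVec
  rw [φ.card_Fset, φ.card_FAset, φ.card_FBset, φ.card_IFset, φ.card_IAset, φ.card_IBset]

end ZoneIso

/-! ## The class -/

/-- **THE CLASS 𝒵 IN SIX-VECTOR FORM**: anchored zones generated from the marked point by pendant attachment at
vertices of unmarked multigraphs, gluing at the anchor, and zone isomorphism. -/
inductive IsZc : {V E T₁ T₂ : Type} → ZoneData V E T₁ T₂ → V → Prop
  /-- the marked point -/
  | point (p q : ℕ) : IsZc (pointZone p q) ()
  /-- a member hung at any vertex of any unmarked multigraph, anchored anywhere in the latter -/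
  | pendant {V₁ E₁ U₁ U₂ V₂ E₂ T₁ T₂ : Type} (Z₁ : ZoneData V₁ E₁ U₁ U₂) (u a : V₁) (Z₂ : ZoneData V₂ E₂ T₁ T₂)
      (a₂ : V₂) : IsZc Z₂ a₂ → IsZc (Pendant.pendant Z₁ u Z₂ a₂) (Sum.inl a)
  /-- two members glued at their anchors -/
  | glue {V₂ E₂ S₁ S₂ V₃ E₃ R₁ R₂ : Type} (Z₂ : ZoneData V₂ E₂ S₁ S₂) (a₂ : V₂) (Z₃ : ZoneData V₃ E₃ R₁ R₂)
      (a₃ : V₃) : IsZc Z₂ a₂ → IsZc Z₃ a₃ → IsZc (AnchorGlue.glue Z₂ a₂ Z₃ a₃) (Sum.inl a₂)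
  /-- an isomorphic copy of a member -/
  | iso {V E T₁ T₂ V' E' T₁' T₂' : Type} {Z : ZoneData V E T₁ T₂} {Z' : ZoneData V' E' T₁' T₂'} (k : V)
      (φ : ZoneIso Z Z') : IsZc Z k → IsZc Z' (φ.v k)

/-- **THE SIX-VECTOR OF EVERY MEMBER LIES IN THE CONE**, for every choice of the finiteness instances. -/
theorem IsZc.inCone {V E T₁ T₂ : Type} {Z : ZoneData V E T₁ T₂} {k : V} (h : IsZc Z k) :
    ∀ (iE : Fintype E) (dE : DecidableEq E) (i₁ : Fintype T₁) (d₁ : DecidableEq T₁) (i₂ : Fintype T₂)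
      (d₂ : DecidableEq T₂), InCone (@sixVec V E T₁ T₂ Z k iE dE i₁ d₁ i₂ d₂) := by
  induction h with
  | point p q =>
    intro iE dE i₁ d₁ i₂ d₂
    convert inCone_sixVec_pointZone p q
  | @pendant V₁ E₁ U₁ U₂ V₂ E₂ T₁ T₂ Z₁ u a Z₂ a₂ _ ih =>
    intro iE dE i₁ d₁ i₂ d₂
    haveI : Finite (E₁ ⊕ E₂) := Finite.of_fintype _
    haveI hf₁ : Finite E₁ := Finite.of_injective (Sum.inl : E₁ → E₁ ⊕ E₂) Sum.inl_injective
    haveI hf₂ : Finite E₂ := Finite.of_injective (Sum.inr : E₂ → E₁ ⊕ E₂) Sum.inr_injective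
    letI jE₁ : Fintype E₁ := Fintype.ofFinite E₁
    letI jE₂ : Fintype E₂ := Fintype.ofFinite E₂
    letI eE₁ : DecidableEq E₁ := Classical.decEq E₁
    letI eE₂ : DecidableEq E₂ := Classical.decEq E₂
    cases Subsingleton.elim iE (@instFintypeSum E₁ E₂ jE₁ jE₂)
    cases Subsingleton.elim dE (@instDecidableEqSum E₁ E₂ eE₁ eE₂)
    exact inCone_sixVec_pendant Z₁ u Z₂ a₂ a (ih jE₂ eE₂ i₁ d₁ i₂ d₂)
  | @glue V₂ E₂ S₁ S₂ V₃ E₃ R₁ R₂ Z₂ a₂ Z₃ a₃ _ _ ih₂ ih₃ =>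
    intro iE dE i₁ d₁ i₂ d₂
    haveI : Finite (E₂ ⊕ E₃) := Finite.of_fintype _
    haveI : Finite (S₁ ⊕ R₁) := Finite.of_fintype _
    haveI : Finite (S₂ ⊕ R₂) := Finite.of_fintype _
    haveI : Finite E₂ := Finite.of_injective (Sum.inl : E₂ → E₂ ⊕ E₃) Sum.inl_injective
    haveI : Finite E₃ := Finite.of_injective (Sum.inr : E₃ → E₂ ⊕ E₃) Sum.inr_injective
    haveI : Finite S₁ := Finite.of_injective (Sum.inl : S₁ → S₁ ⊕ R₁) Sum.inl_injective
    haveI : Finite R₁ := Finite.of_injective (Sum.inr : R₁ → S₁ ⊕ R₁) Sum.inr_injective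
    haveI : Finite S₂ := Finite.of_injective (Sum.inl : S₂ → S₂ ⊕ R₂) Sum.inl_injective
    haveI : Finite R₂ := Finite.of_injective (Sum.inr : R₂ → S₂ ⊕ R₂) Sum.inr_injective
    letI jE₂ : Fintype E₂ := Fintype.ofFinite E₂
    letI jE₃ : Fintype E₃ := Fintype.ofFinite E₃
    letI jS₁ : Fintype S₁ := Fintype.ofFinite S₁
    letI jR₁ : Fintype R₁ := Fintype.ofFinite R₁
    letI jS₂ : Fintype S₂ := Fintype.ofFinite S₂
    letI jR₂ : Fintype R₂ := Fintype.ofFinite R₂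
    letI eE₂ : DecidableEq E₂ := Classical.decEq E₂
    letI eE₃ : DecidableEq E₃ := Classical.decEq E₃
    letI eS₁ : DecidableEq S₁ := Classical.decEq S₁
    letI eR₁ : DecidableEq R₁ := Classical.decEq R₁
    letI eS₂ : DecidableEq S₂ := Classical.decEq S₂
    letI eR₂ : DecidableEq R₂ := Classical.decEq R₂
    cases Subsingleton.elim iE (@instFintypeSum E₂ E₃ jE₂ jE₃)
    cases Subsingleton.elim dE (@instDecidableEqSum E₂ E₃ eE₂ eE₃)
    cases Subsingleton.elim i₁ (@instFintypeSum S₁ R₁ jS₁ jR₁)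
    cases Subsingleton.elim d₁ (@instDecidableEqSum S₁ R₁ eS₁ eR₁)
    cases Subsingleton.elim i₂ (@instFintypeSum S₂ R₂ jS₂ jR₂)
    cases Subsingleton.elim d₂ (@instDecidableEqSum S₂ R₂ eS₂ eR₂)
    exact inCone_sixVec_glue Z₂ a₂ Z₃ a₃ (ih₂ jE₂ eE₂ jS₁ eS₁ jS₂ eS₂) (ih₃ jE₃ eE₃ jR₁ eR₁ jR₂ eR₂)
  | @iso V E T₁ T₂ V' E' T₁' T₂' Z Z' k φ _ ih =>
    intro iE dE i₁ d₁ i₂ d₂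
    haveI : Finite E' := Finite.of_fintype _
    haveI : Finite T₁' := Finite.of_fintype _
    haveI : Finite T₂' := Finite.of_fintype _
    haveI : Finite E := Finite.of_injective φ.e φ.e.injective
    haveI : Finite T₁ := Finite.of_injective φ.t₁ φ.t₁.injective
    haveI : Finite T₂ := Finite.of_injective φ.t₂ φ.t₂.injective
    letI jE : Fintype E := Fintype.ofFinite E
    letI j₁ : Fintype T₁ := Fintype.ofFinite T₁
    letI j₂ : Fintype T₂ := Fintype.ofFinite T₂
    letI eE : DecidableEq E := Classical.decEq E
    letI e₁ : DecidableEq T₁ := Classical.decEq T₁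
    letI e₂ : DecidableEq T₂ := Classical.decEq T₂
    rw [ZoneIso.sixVec_eq φ k]
    exact ih jE eE j₁ e₁ j₂ e₂

/-- **THE INVARIANT (P) ON THE CLASS 𝒵.** -/
theorem IsZc.K4_counts {V E T₁ T₂ : Type} {Z : ZoneData V E T₁ T₂} {k : V} (h : IsZc Z k) [Fintype E]
    [DecidableEq E] [Fintype T₁] [DecidableEq T₁] [Fintype T₂] [DecidableEq T₂] :
    K4 (#(Z.Fset k) : ℝ) (#(Z.T1set k)) (#(Z.T2set k)) (#(Z.Iset k)) :=
  Z.K4_of_inCone_sixVec k (h.inCone _ _ _ _ _ _)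

/-- **THE ONE-ANCHOR (CS) ON THE CLASS 𝒵.** -/
theorem IsZc.zoneCSConj {V E T₁ T₂ : Type} {Z : ZoneData V E T₁ T₂} {k : V} (h : IsZc Z k) [Fintype E]
    [DecidableEq E] [Fintype T₁] [DecidableEq T₁] [Fintype T₂] [DecidableEq T₂] :
    Z.ZoneCSConj {k} (∅ : Set V) :=
  Z.zoneCSConj_of_inCone_sixVec k (h.inCone _ _ _ _ _ _)

/-- **THE ZONE O-CUBE ON THE CLASS 𝒵** — mine-3's CONJECTURE (ZONE O-CUBE) is a theorem on every zone generated
from marked points by hanging at vertices of unmarked multigraphs and gluing at the anchor, up to isomorphism. -/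
theorem IsZc.zoneOCubeConj {V E T₁ T₂ : Type} {Z : ZoneData V E T₁ T₂} {k : V} (h : IsZc Z k) [Fintype E]
    [DecidableEq E] [Fintype T₁] [DecidableEq T₁] [Fintype T₂] [DecidableEq T₂] :
    Z.ZoneOCubeConj {k} (∅ : Set V) :=
  Z.zoneOCubeConj_of_inCone_sixVec k (h.inCone _ _ _ _ _ _)

end ZoneZ

end PercRepro
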